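import Mathlib
import Literature.Barriers.MatrixMultiplication.YoungSubgroupBarrier
import Summits.MatrixMultiplication.MatrixMultiplication.Theorems.SoloInformedHyperoctahedralPairwise
import HarnessLib

/-!
# The all-subgroups analogue of BCCGU17 Thm. 4.2 is false (solo-informed seat, gen 60)

Blasiak–Church–Cohn–Grochow–Umans (2017), Thm. 4.2 (validated barrier
`Literature.Barriers.MatrixMultiplication.BCCGU2017_thm42`): three YOUNG subgroups of `Sₙ` with
pairwise trivial intersections satisfy `n! / (|H₁||H₂||H₃|)^{2/3} ≥ e^{cn − d√n log n}`.  Its proof uses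
the triple product property only through pairwise triviality, and §5 of the paper asks for an
extension "to all triples of subgroups (not just Young subgroups)".

This file records, in the barrier's own format, that the literal extension is FALSE: the statement
`Thm42AllSubgroups` below — `BCCGU2017_thm42` with `youngSubgroup fᵢ` replaced by arbitrary
subgroups `Hᵢ ≤ Sₙ` — is refuted by the hyperoctahedral point-stabiliser triples of
`SoloInformedHyperoctahedralPairwise` (`exists_pairwise_trivial_triple_sqrt`: for odd `m`, three
pairwise trivially intersecting subgroups of `S_{2m}` with `(2m)!³ ≤ (|H₁||H₂||H₃|·(2m)³)²`), which give
`n!/(|H₁||H₂||H₃|)^{2/3} ≤ n²`, against `e^{cn − d√n log n} > n²` for large `n`.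

* `Thm42AllSubgroups` — the all-subgroups analogue (a `Prop`);
* `bccgu_thm42_of_thm42AllSubgroups` — sanity: it specialises to `BCCGU2017_thm42`;
* `eventually_sq_lt_exp` — `x² < e^{cx − d√x log x}` eventually (`c > 0`);
* `div_rpow_le_sq` — `F³ ≤ (P n³)² ⟹ F/P^{2/3} ≤ n²`;
* `not_thm42AllSubgroups` — the refutation.

Reading: any barrier for all subgroup triples of `Sₙ` must use the ternary condition
`h₁h₂h₃ = 1 ⇒ hᵢ = 1` beyond pairwise triviality.  No statement about `ω`.
-/

namespace Summit.MatrixMultiplication.MatrixMultiplication.Theorems.HyperoctahedralNoYoungBound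

open Real Filter Asymptotics Equiv
open Literature.Barriers.MatrixMultiplication

/-- The all-subgroups analogue of BCCGU17 Thm. 4.2: the barrier fact `BCCGU2017_thm42` with the three
Young subgroups replaced by arbitrary subgroups of `Sₙ` having pairwise trivial intersections. -/
def Thm42AllSubgroups : Prop :=
  ∃ c d : ℝ, 0 < c ∧ 0 < d ∧ ∀ n : ℕ, 2 ≤ n → ∀ (H₁ H₂ H₃ : Subgroup (Perm (Fin n))),
    H₁ ⊓ H₂ = ⊥ → H₂ ⊓ H₃ = ⊥ → H₁ ⊓ H₃ = ⊥ →
      Real.exp (c * n - d * Real.sqrt n * Real.log n) ≤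
        (n.factorial : ℝ) /
          ((Nat.card H₁ * Nat.card H₂ * Nat.card H₃ : ℕ) : ℝ) ^ (2 / 3 : ℝ)

/-- Sanity check: `Thm42AllSubgroups` specialises to the barrier fact `BCCGU2017_thm42`
(Young subgroups are subgroups). -/
theorem bccgu_thm42_of_thm42AllSubgroups (h : Thm42AllSubgroups) : BCCGU2017_thm42 := by
  obtain ⟨c, d, hc, hd, h⟩ := h
  exact ⟨c, d, hc, hd, fun n hn f₁ f₂ f₃ h12 h23 h13 =>
    h n hn (youngSubgroup f₁) (youngSubgroup f₂) (youngSubgroup f₃) h12 h23 h13⟩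

/-- For `c > 0` and any `d`, eventually `x² < exp (c x − d √x log x)`. -/
theorem eventually_sq_lt_exp (c d : ℝ) (hc : 0 < c) :
    ∀ᶠ x : ℝ in atTop, x ^ 2 < Real.exp (c * x - d * Real.sqrt x * Real.log x) := by
  have h1 : (fun x : ℝ => Real.log x) =o[atTop] (fun x => x) := Real.isLittleO_log_id_atTop
  have h2 : (fun x : ℝ => Real.sqrt x * Real.log x) =o[atTop] (fun x => x) := by
    have hl : (fun x : ℝ => Real.log x) =o[atTop] (fun x => x ^ ((1 : ℝ) / 2)) :=
      isLittleO_log_rpow_atTop (by norm_num)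
    have hs : (fun x : ℝ => Real.sqrt x) =O[atTop] (fun x => x ^ ((1 : ℝ) / 2)) := by
      refine (isBigO_refl (fun x : ℝ => x ^ ((1 : ℝ) / 2)) atTop).congr' ?_ EventuallyEq.rfl
      filter_upwards [eventually_ge_atTop (0 : ℝ)] with x hx
      rw [Real.sqrt_eq_rpow]
    refine (hs.mul_isLittleO hl).congr' EventuallyEq.rfl ?_
    filter_upwards [eventually_gt_atTop (0 : ℝ)] with x hx
    rw [← Real.rpow_add hx]
    norm_num
  have h3 := (h2.const_mul_left d).add (h1.const_mul_left 2)
  have h4 := h3.def (half_pos hc)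
  filter_upwards [h4, eventually_gt_atTop (0 : ℝ)] with x hx hx0
  have hx' : d * (Real.sqrt x * Real.log x) + 2 * Real.log x ≤ c / 2 * x := by
    have habs := (le_abs_self (d * (Real.sqrt x * Real.log x) + 2 * Real.log x)).trans hx
    simpa [Real.norm_eq_abs, abs_of_pos hx0] using habs
  have hlt : 2 * Real.log x < c * x - d * Real.sqrt x * Real.log x := by
    have hcx : c / 2 * x < c * x := by nlinarith
    have hassoc : d * Real.sqrt x * Real.log x = d * (Real.sqrt x * Real.log x) := by ring
    linarith
  calc x ^ 2 = Real.exp (2 * Real.log x) := by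
        rw [← Real.exp_log (pow_pos hx0 2), Real.log_pow]
        norm_num
    _ < Real.exp (c * x - d * Real.sqrt x * Real.log x) := Real.exp_lt_exp.mpr hlt

/-- Arithmetic step: `F³ ≤ (P·n³)²` gives `F / P^{2/3} ≤ n²` (over `ℝ`, `P > 0`). -/
theorem div_rpow_le_sq (F P n : ℕ) (hP : 0 < P) (h : F ^ 3 ≤ (P * n ^ 3) ^ 2) :
    (F : ℝ) / (P : ℝ) ^ (2 / 3 : ℝ) ≤ (n : ℝ) ^ 2 := by
  have hR : (F : ℝ) ^ 3 ≤ ((P : ℝ) * (n : ℝ) ^ 3) ^ 2 := by exact_mod_cast h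
  have hP0 : (0 : ℝ) < (P : ℝ) := by exact_mod_cast hP
  have hP23 : (0 : ℝ) < (P : ℝ) ^ (2 / 3 : ℝ) := Real.rpow_pos_of_pos hP0 _
  rw [div_le_iff₀ hP23]
  have hcube : ((n : ℝ) ^ 2 * (P : ℝ) ^ (2 / 3 : ℝ)) ^ 3 = ((P : ℝ) * (n : ℝ) ^ 3) ^ 2 := by
    have hP3 : ((P : ℝ) ^ (2 / 3 : ℝ)) ^ (3 : ℕ) = (P : ℝ) ^ (2 : ℕ) := by
      rw [← Real.rpow_natCast ((P : ℝ) ^ (2 / 3 : ℝ)) 3, ← Real.rpow_mul hP0.le]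
      norm_num
    rw [mul_pow, hP3]
    ring
  refine le_of_not_gt fun hlt => ?_
  have h3 := pow_lt_pow_left₀ hlt (by positivity) (by norm_num : (3 : ℕ) ≠ 0)
  rw [hcube] at h3
  exact absurd (hR.trans_lt h3) (lt_irrefl _)

/-- The all-subgroups analogue of BCCGU17 Thm. 4.2 is false: hyperoctahedral point-stabiliser
triples in `S_{2m}` (`m` odd) are pairwise trivially intersecting with
`n!/(|H₁||H₂||H₃|)^{2/3} ≤ n²`. -/
theorem not_thm42AllSubgroups : ¬ Thm42AllSubgroups := by
  rintro ⟨c, d, hc, hd, h⟩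
  obtain ⟨N, hN⟩ := Filter.eventually_atTop.mp (eventually_sq_lt_exp c d hc)
  set k : ℕ := ⌈N⌉₊ with hk
  have hmo : Odd (2 * k + 1) := ⟨k, rfl⟩
  obtain ⟨H₁, H₂, H₃, h12, h13, h23, hP⟩ :=
    HyperoctahedralPairwise.exists_pairwise_trivial_triple_sqrt (m := 2 * k + 1) hmo
  have hn2 : 2 ≤ 2 * (2 * k + 1) := by omega
  have hnN : N ≤ ((2 * (2 * k + 1) : ℕ) : ℝ) := by
    have hkn : (k : ℝ) ≤ ((2 * (2 * k + 1) : ℕ) : ℝ) := by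
      exact_mod_cast (show k ≤ 2 * (2 * k + 1) by omega)
    exact (Nat.le_ceil N).trans hkn
  have hPpos : 0 < Nat.card H₁ * Nat.card H₂ * Nat.card H₃ :=
    Nat.mul_pos (Nat.mul_pos Nat.card_pos Nat.card_pos) Nat.card_pos
  have hexp := h (2 * (2 * k + 1)) hn2 H₁ H₂ H₃ h12 h23 h13
  have hsq := hN ((2 * (2 * k + 1) : ℕ) : ℝ) hnN
  have key := div_rpow_le_sq _ _ _ hPpos hP
  exact absurd ((hsq.trans_le hexp).trans_le key) (lt_irrefl _)

end Summit.MatrixMultiplication.MatrixMultiplication.Theorems.HyperoctahedralNoYoungBound
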